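import Literature.Analysis.Quadrature.ChebyshevLobattoRule
import HarnessLib

/-!
# DCT-II column orthonormality (kernel of the `BoxLatticeFSum` pieces SB / MC)  (decomp-a2c · hand-1 g9)

The DCT-II block waves `g_q = Σ_B dctCoeff K q B · u_B` of the box carving (`…Theorems.BoxLatticeFSumCarving`,
lens-6 g29) are an orthonormal change of basis of the block span: per axis,
`Σ_{a<K} (c_a/K) cos(π a (b+½)/K) cos(π a (b'+½)/K) = δ_{bb'}`, `c_0 = 1`, `c_a = 2` (`a ≥ 1`).
This is the identity behind both «DCT Parseval `Σ_q n(g_q) = Σ_B n(u_B)`» (MC) and the path-Laplacian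
f-sum identity (SB).  We prove it from the tree's full-period cosine Riemann sum
`Literature.Analysis.Quadrature.ChebyshevLobattoRule.sum_range_cos_mul_pi_div_add_succ`
(`Σ_{k<K} cos(mkπ/K) + Σ_{1≤k≤K} cos(mkπ/K) = 2K·𝟙(2K ∣ m)`):

* `two_mul_sum_cos_sub_one` — the Dirichlet-kernel value `2Σ_{k<K} cos(mkπ/K) − 1 = 2K·𝟙(2K ∣ m) − (−1)^m`;
* `dct1_orthonormal` — the 1D column orthonormality, stated with exactly the per-axis factor of
  `dctCoeff` (`√((if a = 0 then 1 else 2)/K) · cos(π a (b + 1/2)/K)`);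
* `dct3_orthonormal` — the tensorised identity on `Fin 3 → Fin K` (`Finset.prod_univ_sum`), i.e.
  `Σ_q dctCoeff K q B · dctCoeff K q B' = δ_{BB'}` once `dctCoeff` is unfolded.

Theses-free (imports only the quadrature file); no definitions, no `sorry`. [folklore: Strang 1999, SIAM Rev. 41, §1]
-/

noncomputable section

open Finset Real
open scoped BigOperators

namespace Summit.AtomisticToContinuum.BoseEinsteinCondensation.Theorems.BoxLatticeFSumDCT

/-- **Dirichlet-kernel value at the DCT nodes**: `2 Σ_{k<K} cos(m k π/K) − 1 = 2K·𝟙(2K ∣ m) − (−1)^m`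
for every integer `m` and `K ≥ 1`. [folklore] -/
theorem two_mul_sum_cos_sub_one {K : ℕ} (hK : K ≠ 0) (m : ℤ) :
    2 * (∑ k ∈ range K, Real.cos (m * k * π / K)) - 1 =
      (if (2 * K : ℤ) ∣ m then 2 * (K : ℝ) else 0) - (-1 : ℝ) ^ m := by
  have h := Literature.Analysis.Quadrature.ChebyshevLobattoRule.sum_range_cos_mul_pi_div_add_succ hK m
  have hKr : (K : ℝ) ≠ 0 := by exact_mod_cast hK
  have h1 := Finset.sum_range_succ (fun k : ℕ => Real.cos (m * (k : ℝ) * π / K)) K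
  have h2 := Finset.sum_range_succ' (fun k : ℕ => Real.cos (m * (k : ℝ) * π / K)) K
  have hf0 : Real.cos ((m : ℝ) * ((0 : ℕ) : ℝ) * π / K) = 1 := by simp
  have hfK : Real.cos ((m : ℝ) * ((K : ℕ) : ℝ) * π / K) = (-1 : ℝ) ^ m := by
    rw [show (m : ℝ) * ((K : ℕ) : ℝ) * π / K = m * π by field_simp]
    exact Real.cos_int_mul_pi m
  have hshift : ∑ k ∈ range K, Real.cos (m * ((k + 1 : ℕ) : ℝ) * π / K) =
      (∑ k ∈ range K, Real.cos (m * (k : ℝ) * π / K)) - 1 + (-1 : ℝ) ^ m := by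
    rw [hf0] at h2; rw [hfK] at h1
    linarith
  rw [hshift] at h
  linarith

/-- The weights `c_a = (if a = 0 then 1 else 2)` against any `g`: `Σ_{k<K} c_k g k = 2 Σ_{k<K} g k − g 0`
(`K ≥ 1`). [folklore] -/
theorem sum_weight_eq {K : ℕ} (hK : 0 < K) (g : ℕ → ℝ) :
    ∑ k ∈ range K, (if k = 0 then (1 : ℝ) else 2) * g k = 2 * (∑ k ∈ range K, g k) - g 0 := by
  have hmem : 0 ∈ range K := Finset.mem_range.2 hK
  have h1 : ∑ k ∈ range K, (if k = 0 then (1 : ℝ) else 2) * g k =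
      ∑ k ∈ range K, (2 * g k - (if k = 0 then g k else 0)) := by
    refine Finset.sum_congr rfl fun k _ => ?_
    by_cases hk : k = 0
    · subst hk; simp; ring
    · simp [hk]
  rw [h1, Finset.sum_sub_distrib, ← Finset.mul_sum, Finset.sum_ite_eq' (range K) 0 g, if_pos hmem]

/-- **1D DCT-II column orthonormality**, with exactly the per-axis factor of `dctCoeff`:
`Σ_{a<K} √(c_a/K) cos(π a (b+½)/K) · √(c_a/K) cos(π a (b'+½)/K) = δ_{bb'}`. [folklore] -/
theorem dct1_orthonormal {K : ℕ} (hK : 0 < K) (b b' : Fin K) :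
    ∑ a : Fin K, (Real.sqrt ((if ((a : ℕ) = 0) then (1 : ℝ) else 2) / (K : ℝ)) *
        Real.cos (Real.pi * ((a : ℕ) : ℝ) * (((b : ℕ) : ℝ) + 1 / 2) / (K : ℝ))) *
      (Real.sqrt ((if ((a : ℕ) = 0) then (1 : ℝ) else 2) / (K : ℝ)) *
        Real.cos (Real.pi * ((a : ℕ) : ℝ) * (((b' : ℕ) : ℝ) + 1 / 2) / (K : ℝ))) =
    if b = b' then 1 else 0 := by
  have hKr : (0 : ℝ) < K := by exact_mod_cast hK
  have hK0 : K ≠ 0 := hK.ne'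
  -- the two integer frequencies
  set m₁ : ℤ := (b : ℤ) - (b' : ℤ) with hm₁
  set m₂ : ℤ := (b : ℤ) + (b' : ℤ) + 1 with hm₂
  -- termwise: `√t x · √t y = t (x y)` and the product-to-sum formula
  have hterm : ∀ a : ℕ,
      (Real.sqrt ((if (a = 0) then (1 : ℝ) else 2) / (K : ℝ)) *
          Real.cos (Real.pi * (a : ℝ) * (((b : ℕ) : ℝ) + 1 / 2) / (K : ℝ))) *
        (Real.sqrt ((if (a = 0) then (1 : ℝ) else 2) / (K : ℝ)) *
          Real.cos (Real.pi * (a : ℝ) * (((b' : ℕ) : ℝ) + 1 / 2) / (K : ℝ))) =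
      (1 / (2 * (K : ℝ))) * ((if a = 0 then (1 : ℝ) else 2) *
        (Real.cos (m₁ * a * π / K) + Real.cos (m₂ * a * π / K))) := by
    intro a
    have ht : 0 ≤ (if (a = 0) then (1 : ℝ) else 2) / (K : ℝ) := by positivity
    have hsq : Real.sqrt ((if (a = 0) then (1 : ℝ) else 2) / (K : ℝ)) *
        Real.sqrt ((if (a = 0) then (1 : ℝ) else 2) / (K : ℝ)) = (if (a = 0) then (1 : ℝ) else 2) / (K : ℝ) :=
      Real.mul_self_sqrt ht
    have hcos : 2 * (Real.cos (Real.pi * (a : ℝ) * (((b : ℕ) : ℝ) + 1 / 2) / (K : ℝ)) *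
        Real.cos (Real.pi * (a : ℝ) * (((b' : ℕ) : ℝ) + 1 / 2) / (K : ℝ))) =
        Real.cos (m₁ * a * π / K) + Real.cos (m₂ * a * π / K) := by
      rw [show ∀ x y : ℝ, 2 * (Real.cos x * Real.cos y) = Real.cos (x - y) + Real.cos (x + y) from
        fun x y => by rw [Real.cos_sub, Real.cos_add]; ring]
      congr 1
      · congr 1; rw [hm₁]; push_cast; ring
      · congr 1; rw [hm₂]; push_cast; ring
    calc _ = (Real.sqrt ((if (a = 0) then (1 : ℝ) else 2) / (K : ℝ)) *
          Real.sqrt ((if (a = 0) then (1 : ℝ) else 2) / (K : ℝ))) *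
          (Real.cos (Real.pi * (a : ℝ) * (((b : ℕ) : ℝ) + 1 / 2) / (K : ℝ)) *
            Real.cos (Real.pi * (a : ℝ) * (((b' : ℕ) : ℝ) + 1 / 2) / (K : ℝ))) := by ring
      _ = _ := by rw [hsq, ← hcos]; field_simp
  -- pass to `range K` and split the weights
  rw [Fin.sum_univ_eq_sum_range (fun a : ℕ =>
      (Real.sqrt ((if (a = 0) then (1 : ℝ) else 2) / (K : ℝ)) *
          Real.cos (Real.pi * (a : ℝ) * (((b : ℕ) : ℝ) + 1 / 2) / (K : ℝ))) *
        (Real.sqrt ((if (a = 0) then (1 : ℝ) else 2) / (K : ℝ)) *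
          Real.cos (Real.pi * (a : ℝ) * (((b' : ℕ) : ℝ) + 1 / 2) / (K : ℝ)))) K]
  simp_rw [hterm]
  rw [← Finset.mul_sum]
  have hsplit : ∑ k ∈ range K, (if k = 0 then (1 : ℝ) else 2) *
      (Real.cos (m₁ * k * π / K) + Real.cos (m₂ * k * π / K)) =
      (2 * (∑ k ∈ range K, Real.cos (m₁ * k * π / K)) - 1) +
        (2 * (∑ k ∈ range K, Real.cos (m₂ * k * π / K)) - 1) := by
    have h := sum_weight_eq hK (fun k => Real.cos (m₁ * k * π / K) + Real.cos (m₂ * k * π / K))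
    simp only [Nat.cast_zero, mul_zero, zero_mul, zero_div, Real.cos_zero] at h
    rw [h, Finset.sum_add_distrib]; ring
  rw [hsplit, two_mul_sum_cos_sub_one hK0 m₁, two_mul_sum_cos_sub_one hK0 m₂]
  -- the parities: `(-1)^{m₂} = -(-1)^{m₁}`
  have hpar : (-1 : ℝ) ^ m₂ = -(-1 : ℝ) ^ m₁ := by
    have h2 : m₂ = m₁ + (2 * (b' : ℤ) + 1) := by rw [hm₁, hm₂]; ring
    have hodd : Odd (2 * (b' : ℤ) + 1) := ⟨(b' : ℤ), by ring⟩
    rw [h2, zpow_add₀ (by norm_num : (-1 : ℝ) ≠ 0), hodd.neg_one_zpow]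
    ring
  -- `m₂ ∈ [1, 2K-1]` is never divisible by `2K`
  have hb : (b : ℤ) < K := by exact_mod_cast b.isLt
  have hb' : (b' : ℤ) < K := by exact_mod_cast b'.isLt
  have hb0 : 0 ≤ (b : ℤ) := by positivity
  have hb'0 : 0 ≤ (b' : ℤ) := by positivity
  have hm₂ndvd : ¬ (2 * K : ℤ) ∣ m₂ := by
    intro hd
    obtain ⟨c, hc⟩ := hd
    have h1 : 0 < m₂ := by rw [hm₂]; linarith
    have h2 : m₂ < 2 * K := by rw [hm₂]; linarith
    rcases lt_trichotomy c 0 with hc0 | hc0 | hc0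
    · nlinarith
    · rw [hc0, mul_zero] at hc; linarith
    · nlinarith
  rw [if_neg hm₂ndvd]
  by_cases hbb : b = b'
  · subst hbb
    have hm₁0 : m₁ = 0 := by rw [hm₁]; ring
    rw [if_pos (by rw [hm₁0]; exact dvd_zero _), if_pos rfl]
    field_simp
    linarith [hpar]
  · have hm₁ne : m₁ ≠ 0 := by
      rw [hm₁]; intro h
      apply hbb; apply Fin.ext
      have : (b : ℤ) = (b' : ℤ) := by linarith
      exact_mod_cast this
    have hm₁ndvd : ¬ (2 * K : ℤ) ∣ m₁ := by
      intro hd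
      obtain ⟨c, hc⟩ := hd
      have h1 : -(K : ℤ) < m₁ := by rw [hm₁]; linarith
      have h2 : m₁ < K := by rw [hm₁]; linarith
      rcases lt_trichotomy c 0 with hc0 | hc0 | hc0
      · nlinarith
      · exact hm₁ne (by rw [hc, hc0, mul_zero])
      · nlinarith
    rw [if_neg hm₁ndvd, if_neg hbb]
    rw [hpar]; ring

/-- **3D DCT-II orthonormality** (tensorised): with the per-axis factors of `dctCoeff`,
`Σ_{q : Fin 3 → Fin K} (∏_j f(q_j, B_j)) · (∏_j f(q_j, B'_j)) = δ_{BB'}`. [folklore] -/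
theorem dct3_orthonormal {K : ℕ} (hK : 0 < K) (B B' : Fin 3 → Fin K) :
    ∑ q : Fin 3 → Fin K,
      (∏ j : Fin 3, Real.sqrt ((if ((q j : ℕ) = 0) then (1 : ℝ) else 2) / (K : ℝ)) *
          Real.cos (Real.pi * ((q j : ℕ) : ℝ) * ((((B j : Fin K) : ℕ) : ℝ) + 1 / 2) / (K : ℝ))) *
      (∏ j : Fin 3, Real.sqrt ((if ((q j : ℕ) = 0) then (1 : ℝ) else 2) / (K : ℝ)) *
          Real.cos (Real.pi * ((q j : ℕ) : ℝ) * ((((B' j : Fin K) : ℕ) : ℝ) + 1 / 2) / (K : ℝ))) =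
    if B = B' then 1 else 0 := by
  classical
  -- combine the two products and un-tensorise
  have h1 : ∀ q : Fin 3 → Fin K,
      (∏ j : Fin 3, Real.sqrt ((if ((q j : ℕ) = 0) then (1 : ℝ) else 2) / (K : ℝ)) *
          Real.cos (Real.pi * ((q j : ℕ) : ℝ) * ((((B j : Fin K) : ℕ) : ℝ) + 1 / 2) / (K : ℝ))) *
      (∏ j : Fin 3, Real.sqrt ((if ((q j : ℕ) = 0) then (1 : ℝ) else 2) / (K : ℝ)) *
          Real.cos (Real.pi * ((q j : ℕ) : ℝ) * ((((B' j : Fin K) : ℕ) : ℝ) + 1 / 2) / (K : ℝ))) =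
      ∏ j : Fin 3, ((Real.sqrt ((if ((q j : ℕ) = 0) then (1 : ℝ) else 2) / (K : ℝ)) *
          Real.cos (Real.pi * ((q j : ℕ) : ℝ) * ((((B j : Fin K) : ℕ) : ℝ) + 1 / 2) / (K : ℝ))) *
        (Real.sqrt ((if ((q j : ℕ) = 0) then (1 : ℝ) else 2) / (K : ℝ)) *
          Real.cos (Real.pi * ((q j : ℕ) : ℝ) * ((((B' j : Fin K) : ℕ) : ℝ) + 1 / 2) / (K : ℝ)))) :=
    fun q => (Finset.prod_mul_distrib).symm
  simp_rw [h1]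
  rw [← Fintype.prod_sum (fun (j : Fin 3) (a : Fin K) =>
      (Real.sqrt ((if ((a : ℕ) = 0) then (1 : ℝ) else 2) / (K : ℝ)) *
          Real.cos (Real.pi * ((a : ℕ) : ℝ) * ((((B j : Fin K) : ℕ) : ℝ) + 1 / 2) / (K : ℝ))) *
        (Real.sqrt ((if ((a : ℕ) = 0) then (1 : ℝ) else 2) / (K : ℝ)) *
          Real.cos (Real.pi * ((a : ℕ) : ℝ) * ((((B' j : Fin K) : ℕ) : ℝ) + 1 / 2) / (K : ℝ))))]
  simp_rw [dct1_orthonormal hK]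
  by_cases hBB : B = B'
  · subst hBB; simp
  · rw [if_neg hBB]
    obtain ⟨j, hj⟩ : ∃ j, B j ≠ B' j := by
      by_contra hcon
      push Not at hcon
      exact hBB (funext hcon)
    exact Finset.prod_eq_zero (Finset.mem_univ j) (if_neg hj)

end Summit.AtomisticToContinuum.BoseEinsteinCondensation.Theorems.BoxLatticeFSumDCT

end
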